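import Literature.MathematicalPhysics.StatisticalMechanics.LennardJonesClusters

/-!
# Energy decomposition along a sub-configuration (stub `stub_decomp` of line `Sketch`)

Supporting file for the crux `FarFieldGapR` (item stmt-AtomisticToContinuum-14969, route
`PhononSlackCertificates`).  For a configuration `x : Fin N → ℝ³` and an embedding
`e : Fin n ↪ Fin N` with range `U = Finset.univ.map e`, the sum over `U` of the half site
energies of `x` splits as the interaction energy of the sub-configuration `x ∘ e` plus half of
the cross terms between `U` and `Uᶜ`:

`∑_{i ∈ U} ½ ∑_{j ≠ i} V(|xᵢ - xⱼ|) = 𝓔(x ∘ e) + ½ ∑_{k} ∑_{j ∉ U} V(|x_{e k} - xⱼ|)`.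

Pure finite-sum bookkeeping (`Finset.sum_map`, `Finset.sum_erase_eq_sub`,
`Finset.sum_add_sum_compl`) on top of the double-counting identity
`two_mul_interactionEnergy : 2 𝓔(y) = ∑ᵢ 𝓔ⁱ(y)`.
-/

noncomputable section

open scoped BigOperators

namespace Summit.AtomisticToContinuum.Crystallization.Theorems.PhononSlackCertificatesFarFieldGapR

open Literature.MathematicalPhysics.StatisticalMechanics

/-- One row of the decomposition: for a particle `e k` of the sub-configuration, the site sum
`∑_{j ≠ e k} V(|x_{e k} - xⱼ|)` in the full configuration is the site energy of `k` in `x ∘ e`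
plus the cross terms with the complement of the range of `e`. -/
private theorem decomp_row (V : ℝ → ℝ) {N n : ℕ} (x : Fin N → EuclideanSpace ℝ (Fin 3))
    (e : Fin n ↪ Fin N) (k : Fin n) :
    ∑ j ∈ Finset.univ.erase (e k), V (dist (x (e k)) (x j)) =
      siteEnergy V (x ∘ e) k + ∑ j ∈ (Finset.univ.map e)ᶜ, V (dist (x (e k)) (x j)) := by
  rw [Finset.sum_erase_eq_sub (Finset.mem_univ _),
    ← Finset.sum_add_sum_compl (Finset.univ.map e), Finset.sum_map, siteEnergy,
    Finset.sum_erase_eq_sub (Finset.mem_univ _)]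
  simp only [Function.comp_apply]
  ring

/-- ENERGY DECOMPOSITION (finite sums).  The sum over `U = Finset.univ.map e` of the half site
energies in `x` is the interaction energy of the sub-configuration `x ∘ e` plus half the cross
terms with `Uᶜ`. -/
theorem stub_decomp :
    ∀ (V : ℝ → ℝ) (N n : ℕ) (x : Fin N → EuclideanSpace ℝ (Fin 3)) (e : Fin n ↪ Fin N),
      ∑ i ∈ Finset.univ.map e, (1 / 2 : ℝ) * (∑ j ∈ Finset.univ.erase i, V (dist (x i) (x j))) =
        interactionEnergy V (x ∘ e) +
          (1 / 2 : ℝ) * ∑ k : Fin n, ∑ j ∈ (Finset.univ.map e)ᶜ, V (dist (x (e k)) (x j)) := by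
  intro V N n x e
  rw [Finset.sum_map]
  simp_rw [decomp_row V x e, mul_add, Finset.sum_add_distrib, ← Finset.mul_sum]
  linear_combination (-(1 / 2) : ℝ) * two_mul_interactionEnergy V (x ∘ e)

end Summit.AtomisticToContinuum.Crystallization.Theorems.PhononSlackCertificatesFarFieldGapR

end
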